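import Mathlib
import HarnessLib
import Summits.NavierStokesRegularity.NavierStokesRegularity.Theses.LocalRuledPressureDoor

/-!
# `LocalRuledPressureDoor.Assembly` (item stmt-NavierStokesRegularity-28001) — pure logic

`Assembly` is `LocalPointZoomSimilarityPressure → RuledPressureCollapse → PressurelessProfileRigidity → Target`, i.e. the type of the
route's planner-authored deciding theorem `Theses.LocalRuledPressureDoor.closes` (kernel-checked in the route file); this item is
that composition BY NAME.

HONEST FRAMING: bookkeeping; the door's `Target` is NOT proved (it hangs on the two open cruxes 27998/27999); nothing here bears on
Navier–Stokes regularity.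
-/

noncomputable section

set_option linter.dupNamespace false

namespace Summit.NavierStokesRegularity.NavierStokesRegularity.Theorems

open Summit.NavierStokesRegularity.NavierStokesRegularity.Theses.LocalRuledPressureDoor

/-- **Item stmt-NavierStokesRegularity-28001** (`LocalRuledPressureDoor.Assembly`): the three items compose to the door's `Target`
— by the route's own kernel-checked deciding theorem `closes`. [folklore] -/
theorem localRuledPressureDoor_assembly_proof :
    Summit.NavierStokesRegularity.NavierStokesRegularity.Theses.LocalRuledPressureDoor.Assembly := by
  unfold Summit.NavierStokesRegularity.NavierStokesRegularity.Theses.LocalRuledPressureDoor.Assembly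
  exact fun h₁ h₂ h₃ => closes h₁ h₂ h₃

end Summit.NavierStokesRegularity.NavierStokesRegularity.Theorems

end
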